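import Summits.CriticalPhenomena.CardyFormulaZ2.Theorems.CardyFlipRussoVoronoiHubFromSmirnovMoebiusEquidistant
import Literature.Probability.LatticeModels.DelaunayGraph
import Mathlib

/-!
# Helper `isDelaunayPair_image_of_clearance` — line `moebius-exact-delaunay-dilation-ward`,
# stub S3 `stub_conformalTransport` (crux `VoronoiHubFromSmirnov`, stmt-CriticalPhenomena-6433)

Benjamini–Schramm 1998, Lemma 4.2, deterministic core in contrapositive form ("defects only occur
at potential defects"): let `h` be `C^{1,1}`-conformal on a convex `B` (`m ≤ ‖h'‖ ≤ Λ`,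
`‖h''‖ ≤ L`, `h''` `L`-Lipschitz) with an injectivity modulus (`dist z w ≥ R₁ ⇒
dist (h z) (h w) ≥ η`).  Then there are `W` and `r₀ > 0` such that whenever two sites `p, q ∈ ω`
lie on a small circle `dist · x = r ≤ r₀` with `closedBall x (2r) ⊆ B` and every other site of
`ω` is at distance `≥ r + W r³` from `x` (clearance `W r³`), the image pair `h p, h q` satisfies
the empty circumscribed ball rule in `h '' ω` (`IsDelaunayPair`).

Proof.  Take the exactly equidistant centre `y`, `dist (h p) y = dist (h q) y = ρ'`, of
`moebius_osculation_equidistant` (constants `C, κ, r₁`), and show `ρ' ≤ dist (h d) y` for every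
other site `d`, `D = dist d x ≥ r + W r³`, `W = C⁺/κ + 1`:
* `D ≤ 2r`: the outer dilation inequality gives `dist (h d) y - ρ' ≥ κ W r³ - C r³ ≥ κ r³`
  (`dic_near_arith`);
* `2r < D < R₁ ≤ m/(4(L+1))`: the secant bounds `‖h₁ x‖ D - L D² ≤ dist (h d) (h x)`,
  `dist (h p) (h x) ≤ ‖h₁ x‖ r + L r²` (`dic_secant_two_sided`, one pass of the mean value
  inequality) and `dist y (h x) ≤ C r²` give `dist (h d) y - ρ' ≥ m r/2 - (L + 2C) r² > 0`
  (`dic_mid_arith`);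
* `D ≥ R₁`: the injectivity modulus gives `dist (h d) (h x) ≥ η`, while `ρ' ≤ (Λ + L + C) r`
  (`dic_far_arith`).
All [folklore]; context: I. Benjamini, O. Schramm, *Conformal invariance of Voronoi
percolation*, Comm. Math. Phys. 197 (1998) 75–107, Lemma 4.2.
-/

noncomputable section

namespace Summit.CriticalPhenomena.CardyFormulaZ2.Cruxes.VoronoiHubFromSmirnov.MoebiusExactDelaunayDilationWard

open Set Metric

/-! ### Secant bounds from the mean value inequality -/

/-- If `h₁` has derivative `h₂` on the convex set `B` and `‖h₂‖ ≤ L` there, then `h₁` is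
`L`-Lipschitz on `B`. [folklore] -/
theorem dic_deriv_lip {h₁ h₂ : ℂ → ℂ} {B : Set ℂ} {L : ℝ} (hB : Convex ℝ B)
    (hd2 : ∀ z ∈ B, HasDerivAt h₁ (h₂ z) z) (hL2 : ∀ z ∈ B, ‖h₂ z‖ ≤ L) {x w : ℂ} (hx : x ∈ B)
    (hw : w ∈ B) : ‖h₁ w - h₁ x‖ ≤ L * ‖w - x‖ :=
  hB.norm_image_sub_le_of_norm_hasDerivWithin_le (fun z hz => (hd2 z hz).hasDerivWithinAt) hL2
    hx hw

/-- **Secant remainder**: under the same hypotheses, if `h` has derivative `h₁` on `B`, then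
`‖h w - h x - h₁ x (w - x)‖ ≤ L ‖w - x‖²` for `x, w ∈ B`. [folklore] -/
theorem dic_secant {h h₁ h₂ : ℂ → ℂ} {B : Set ℂ} {L : ℝ} (hB : Convex ℝ B) (hL : 0 ≤ L)
    (hd1 : ∀ z ∈ B, HasDerivAt h (h₁ z) z) (hd2 : ∀ z ∈ B, HasDerivAt h₁ (h₂ z) z)
    (hL2 : ∀ z ∈ B, ‖h₂ z‖ ≤ L) {x w : ℂ} (hx : x ∈ B) (hw : w ∈ B) :
    ‖h w - h x - h₁ x * (w - x)‖ ≤ L * ‖w - x‖ ^ 2 := by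
  have hS : Convex ℝ (B ∩ closedBall x ‖w - x‖) := hB.inter (convex_closedBall _ _)
  have hxS : x ∈ B ∩ closedBall x ‖w - x‖ := ⟨hx, mem_closedBall_self (norm_nonneg _)⟩
  have hwS : w ∈ B ∩ closedBall x ‖w - x‖ := ⟨hw, mem_closedBall_iff_norm.2 le_rfl⟩
  exact crd_taylor_remainder (h₁ := h) (h₂ := h₁) hS (fun z hz => (hd1 z hz.1).hasDerivWithinAt)
    hxS (fun z hz => mem_closedBall_iff_norm.1 hz.2)
    (fun z hz => (dic_deriv_lip hB hd2 hL2 hx hz.1).trans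
      (mul_le_mul_of_nonneg_left (mem_closedBall_iff_norm.1 hz.2) hL)) (norm_nonneg _) hL hwS

/-- **Two-sided secant bounds**: `‖h₁ x‖ D - L D² ≤ dist (h w) (h x) ≤ ‖h₁ x‖ D + L D²`,
`D = dist w x`, for `x, w` in the convex set `B`. [folklore] -/
theorem dic_secant_two_sided {h h₁ h₂ : ℂ → ℂ} {B : Set ℂ} {L : ℝ} (hB : Convex ℝ B)
    (hL : 0 ≤ L) (hd1 : ∀ z ∈ B, HasDerivAt h (h₁ z) z) (hd2 : ∀ z ∈ B, HasDerivAt h₁ (h₂ z) z)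
    (hL2 : ∀ z ∈ B, ‖h₂ z‖ ≤ L) {x w : ℂ} (hx : x ∈ B) (hw : w ∈ B) :
    ‖h₁ x‖ * dist w x - L * dist w x ^ 2 ≤ dist (h w) (h x) ∧
      dist (h w) (h x) ≤ ‖h₁ x‖ * dist w x + L * dist w x ^ 2 := by
  have key := dic_secant hB hL hd1 hd2 hL2 hx hw
  have hn : ‖h₁ x * (w - x)‖ = ‖h₁ x‖ * ‖w - x‖ := norm_mul _ _
  rw [dist_eq_norm, dist_eq_norm]
  constructor
  · have h1 := norm_sub_norm_le (h₁ x * (w - x)) (h w - h x)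
    rw [norm_sub_rev (h₁ x * (w - x)) (h w - h x)] at h1
    linarith
  · calc ‖h w - h x‖ = ‖(h w - h x - h₁ x * (w - x)) + h₁ x * (w - x)‖ := by rw [sub_add_cancel]
      _ ≤ L * ‖w - x‖ ^ 2 + ‖h₁ x‖ * ‖w - x‖ := norm_add_le_of_le key hn.le
      _ = ‖h₁ x‖ * ‖w - x‖ + L * ‖w - x‖ ^ 2 := add_comm _ _

/-! ### The real arithmetic of the three regimes -/

/-- **Near regime** (`D ≤ 2r`): the outer dilation inequality and the clearance
`D ≥ r + W r³`, `κ W = C⁺ + κ`, give `ρ' ≤ dist (h d) y`. [folklore] -/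
theorem dic_near_arith {κ C C' W r D ρ' dy : ℝ} (hκ : 0 < κ) (hr : 0 < r) (hCC' : C ≤ C')
    (hW : κ * W = C' + κ) (hD : r + W * r ^ 3 ≤ D) (h1 : κ * (D - r) - C * r ^ 3 ≤ dy - ρ') :
    ρ' ≤ dy := by
  have h2 : κ * (W * r ^ 3) ≤ κ * (D - r) := mul_le_mul_of_nonneg_left (by linarith) hκ.le
  have h3 : κ * (W * r ^ 3) = (C' + κ) * r ^ 3 := by rw [← mul_assoc, hW]
  have h4 : C * r ^ 3 ≤ C' * r ^ 3 := mul_le_mul_of_nonneg_right hCC' (by positivity)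
  have h5 : 0 < κ * r ^ 3 := by positivity
  nlinarith

/-- **Middle regime** (`2r < D < R₁`): the secant bounds at `d` and `p`, `dist y (h x) ≤ C' r²`,
`L D ≤ m/4` and `r ≤ m / (2 (L + 2C' + 1))` give `ρ' ≤ dist (h d) y`. [folklore] -/
theorem dic_mid_arith {A D L m r C' ρ' dy dx yx px : ℝ} (hm : 0 < m) (hL : 0 ≤ L) (hC' : 0 ≤ C')
    (hr : 0 < r) (hmA : m ≤ A) (h2 : 2 * r < D) (hLD : L * D ≤ m / 4)
    (hrm : r ≤ m / (2 * (L + 2 * C' + 1))) (hdy : dx ≤ dy + yx) (hpy : ρ' ≤ px + yx)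
    (hyx : yx ≤ C' * r ^ 2) (hup : px ≤ A * r + L * r ^ 2) (hlow : A * D - L * D ^ 2 ≤ dx) :
    ρ' ≤ dy := by
  have hD0 : 0 ≤ D := by linarith
  have h1 : L * D ^ 2 ≤ m / 4 * D := by
    rw [pow_two, ← mul_assoc]; exact mul_le_mul_of_nonneg_right hLD hD0
  have h3 : m / 4 * D ≤ A / 4 * D := mul_le_mul_of_nonneg_right (by linarith) hD0
  have h4 : A * (2 * r) ≤ A * D := mul_le_mul_of_nonneg_left h2.le (by linarith)
  have h5 : r * (2 * (L + 2 * C' + 1)) ≤ m := (le_div_iff₀ (by positivity)).1 hrm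
  have h6 : r * (r * (2 * (L + 2 * C' + 1))) ≤ r * m := mul_le_mul_of_nonneg_left h5 hr.le
  have h7 : m * r ≤ A * r := mul_le_mul_of_nonneg_right hmA hr.le
  nlinarith

/-- **Far regime** (`D ≥ R₁`): the injectivity modulus `η ≤ dist (h d) (h x)`, the secant bound
at `p`, `dist y (h x) ≤ C' r²`, `r ≤ 1` and `r ≤ η / (Λ + L + 2C' + 1)` give
`ρ' ≤ dist (h d) y`. [folklore] -/
theorem dic_far_arith {A Λ L r C' η ρ' dy dx yx px : ℝ} (hL : 0 ≤ L) (hC' : 0 ≤ C') (hr : 0 < r)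
    (hr1 : r ≤ 1) (hΛ : 0 < Λ) (hAΛ : A ≤ Λ) (hrη : r ≤ η / (Λ + L + 2 * C' + 1)) (hη : η ≤ dx)
    (hdy : dx ≤ dy + yx) (hpy : ρ' ≤ px + yx) (hyx : yx ≤ C' * r ^ 2)
    (hup : px ≤ A * r + L * r ^ 2) : ρ' ≤ dy := by
  have h4 : r * (Λ + L + 2 * C' + 1) ≤ η := (le_div_iff₀ (by positivity)).1 hrη
  have hr2 : r ^ 2 ≤ r := by nlinarith
  have h5 : A * r ≤ Λ * r := mul_le_mul_of_nonneg_right hAΛ hr.le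
  have h6 : L * r ^ 2 ≤ L * r := mul_le_mul_of_nonneg_left hr2 hL
  have h7 : C' * r ^ 2 ≤ C' * r := mul_le_mul_of_nonneg_left hr2 hC'
  nlinarith

/-! ### The statement -/

/-- **BS98 Lemma 4.2 (core): clearance implies the image pair is Delaunay.**  Under the `C^{1,1}`
conformality hypotheses on the convex set `B` (`m ≤ ‖h₁‖ ≤ Λ`, `‖h₂‖ ≤ L`, `h₂` `L`-Lipschitz,
`h' = h₁`, `h₁' = h₂`) and the injectivity modulus `dist z w ≥ R₁ ⇒ dist (h z) (h w) ≥ η`,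
`R₁ ≤ m/(4(L+1))`, there are `W` and `r₀ > 0` such that: if `p, q ∈ ω ⊆ B` lie on the circle
`dist · x = r`, `0 < r ≤ r₀`, `closedBall x (2r) ⊆ B`, and every other site of `ω` is at distance
`≥ r + W r³` from `x`, then `IsDelaunayPair (h '' ω) (h p) (h q)`. -/
theorem isDelaunayPair_image_of_clearance : ∀ (h h₁ h₂ : ℂ → ℂ) (B : Set ℂ) (L m Λ η R₁ : ℝ), Convex ℝ B → 0 < m → 0 < η → 0 < R₁ → R₁ ≤ m / (4 * (L + 1)) → (∀ z ∈ B, HasDerivAt h (h₁ z) z) → (∀ z ∈ B, HasDerivAt h₁ (h₂ z) z) → (∀ z ∈ B, m ≤ ‖h₁ z‖) → (∀ z ∈ B, ‖h₁ z‖ ≤ Λ) → (∀ z ∈ B, ‖h₂ z‖ ≤ L) → (∀ z ∈ B, ∀ w ∈ B, ‖h₂ z - h₂ w‖ ≤ L * ‖z - w‖) → (∀ z ∈ B, ∀ w ∈ B, R₁ ≤ dist z w → η ≤ dist (h z) (h w)) → ∃ W r₀ : ℝ, 0 < r₀ ∧ ∀ (ω : Set ℂ) (x p q : ℂ) (r :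 ℝ), ω ⊆ B → 0 < r → r ≤ r₀ → Metric.closedBall x (2 * r) ⊆ B → p ∈ ω → q ∈ ω → dist p x = r → dist q x = r → (∀ d ∈ ω, d ≠ p → d ≠ q → r + W * r ^ 3 ≤ dist d x) → Literature.Probability.LatticeModels.IsDelaunayPair (h '' ω) (h p) (h q) := by
  intro h h₁ h₂ B L m Λ η R₁ hB hm hη hR₁ hR₁m hd1 hd2 hm1 hΛ1 hL2 hLip hinj
  rcases Set.eq_empty_or_nonempty B with rfl | ⟨z₀, hz₀⟩
  · exact ⟨0, 1, one_pos, fun ω x p q r _ hr _ hsub =>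
      absurd (hsub (mem_closedBall_self (by positivity))) (Set.notMem_empty x)⟩
  have hL : 0 ≤ L := (norm_nonneg _).trans (hL2 z₀ hz₀)
  have hΛ : 0 < Λ := hm.trans_le ((hm1 z₀ hz₀).trans (hΛ1 z₀ hz₀))
  obtain ⟨C, κ, r₁, hκ, hr₁, hmain⟩ :=
    moebius_osculation_equidistant h h₁ h₂ B L m hB hm hd1 hd2 hm1 hL2 hLip
  -- the constants
  set C' : ℝ := max C 0 with hC'_def
  have hC' : 0 ≤ C' := le_max_right _ _
  have hCC' : C ≤ C' := le_max_left _ _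
  have hW : κ * (C' / κ + 1) = C' + κ := by field_simp
  refine ⟨C' / κ + 1,
    min r₁ (min 1 (min (m / (2 * (L + 2 * C' + 1))) (η / (Λ + L + 2 * C' + 1)))),
    lt_min hr₁ (lt_min one_pos (lt_min (by positivity) (by positivity))), ?_⟩
  intro ω x p q r hω hr hr0 hsub hpω hqω hpx hqx hclear
  simp only [le_min_iff] at hr0
  obtain ⟨hrr₁, hr1, hrm, hrη⟩ := hr0
  obtain ⟨y, ρ', hpy, hqy, hyx, hz⟩ := hmain x r hr hrr₁ hsub p q hpx hqx
  refine ⟨y, ρ', hpy, hqy, ?_⟩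
  rintro _ ⟨d, hd, rfl⟩
  -- the sites `p`, `q` themselves
  by_cases hdp : d = p
  · rw [hdp, hpy]
  by_cases hdq : d = q
  · rw [hdq, hqy]
  -- another site `d`: clearance, and the three regimes
  have hD := hclear d hd hdp hdq
  have hxB : x ∈ B := hsub (mem_closedBall_self (by positivity))
  have hdB : d ∈ B := hω hd
  have hyx' : dist y (h x) ≤ C' * r ^ 2 := hyx.trans (mul_le_mul_of_nonneg_right hCC' (by positivity))
  have hdy : dist (h d) (h x) ≤ dist (h d) y + dist y (h x) := dist_triangle _ _ _
  have hpy' : ρ' ≤ dist (h p) (h x) + dist y (h x) := by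
    rw [← hpy, dist_comm y (h x)]; exact dist_triangle _ _ _
  have hup : dist (h p) (h x) ≤ ‖h₁ x‖ * r + L * r ^ 2 := by
    have := (dic_secant_two_sided hB hL hd1 hd2 hL2 hxB (hω hpω)).2; rwa [hpx] at this
  rcases le_or_gt (dist d x) (2 * r) with h2 | h2
  · -- near regime
    have hW0 : 0 ≤ (C' / κ + 1) * r ^ 3 := by positivity
    have h1 := (hz d (mem_closedBall.2 h2)).1 (by linarith)
    exact dic_near_arith hκ hr hCC' hW hD h1
  rcases lt_or_ge (dist d x) R₁ with h3 | h3
  · -- middle regime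
    have hD1 : dist d x * (4 * (L + 1)) ≤ m := (le_div_iff₀ (by positivity)).1 (h3.le.trans hR₁m)
    have hLD : L * dist d x ≤ m / 4 := by nlinarith [dist_nonneg (x := d) (y := x)]
    exact dic_mid_arith hm hL hC' hr (hm1 x hxB) h2 hLD hrm hdy hpy' hyx' hup
      (dic_secant_two_sided hB hL hd1 hd2 hL2 hxB hdB).1
  · -- far regime
    exact dic_far_arith hL hC' hr hr1 hΛ (hΛ1 x hxB) hrη (hinj d hdB x hxB h3) hdy hpy' hyx' hup

end Summit.CriticalPhenomena.CardyFormulaZ2.Cruxes.VoronoiHubFromSmirnov.MoebiusExactDelaunayDilationWard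

end
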